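import Literature.Geometry.Lorentzian.CauchyDevelopmentOneJet
import HarnessLib

/-!
# The one-jet of a map of data embeddings along the data hypersurface: pointwise form

`CauchyDevelopmentOneJet.lean` proves that a time-orientation preserving isometric immersion
`ψ : M₁ → M₂` between the spacetimes of two data embeddings `𝒮₁`, `𝒮₂` of the same data with
`ψ ∘ ι₁ = ι₂` maps the future unit normal to the future unit normal (`DataEmbedding.mfderiv_normal`)
and that two such maps have the same differential along `ι₁(X)`
(`DataEmbedding.mfderiv_eq_mfderiv_of_comp_embed_eq`; Sbierski 2016, §3.1, proof of the corollary to
the first lemma: "they both map the future normal of `Σ` onto the future normal of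
`ψ₁(Σ) = ψ₂(Σ)`. Thus, the differentials of `ψ₁` and `ψ₂` agree on `Σ`"). The hypotheses there
are GLOBAL (`ψ` isometric and orientation preserving everywhere). This file records the same
statements with the hypotheses only AT THE POINT `ι₁ x` — the form in which they are used for maps
that are isometric on an open region `U` only, at points of `ι₁(X) ⊆ ∂U` or of `ι₁(X) ⊆ U`
(Sbierski 2016, §3.2, proof of Thm. 12: "`(dψ)|_S = (dφ)|_S`" for the restarted embedding `φ` and
the extension `ψ` of the original one):

* `TimeOrientation.isFutureDirected_mfderiv_at` — pointwise timecone transport: if `dψ_y` is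
  isometric and sends the orienting vector into the future cone, it sends every future-directed
  vector to a future-directed vector (O'Neill 1983, Ch. 5, Lemma 5.29 and p. 145);
* `DataEmbedding.mfderiv_normal_at` — `dψ_{ι₁ x} ν₁(x) = ν₂(x)`;
* `DataEmbedding.mfderiv_eq_mfderiv_of_comp_embed_eq_at` — two maps, each differentiable,
  isometric and orientation preserving at `ι₁ x` and carrying `ι₁` to `ι₂`, have the same
  differential at `ι₁ x`.

Everything is proved (the proofs are those of `CauchyDevelopmentOneJet.lean`, localised); no
definitions, no named facts (D-0026).

## References

* J. Sbierski, Ann. Henri Poincaré 17 (2016) 301–329 = arXiv:1309.7591, §3.1 (corollary to the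
  first lemma) and §3.2, proof of Thm. 12. [Sbierski2016AHP]
* B. O'Neill, *Semi-Riemannian geometry with applications to relativity*, Academic Press 1983,
  Ch. 5, Lemma 5.26, Lemma 5.29 and p. 145. [ONeillSemiRiemannian1983]
-/

noncomputable section

open Bundle Set Function Module
open scoped Manifold ContDiff Topology

namespace Literature.Geometry.Lorentzian

universe u

/-! ### Pointwise timecone transport -/

section Timecone

variable {E : Type*} [NormedAddCommGroup E] [NormedSpace ℝ E] {H : Type*} [TopologicalSpace H]
  {I : ModelWithCorners ℝ E H} {n : ℕ∞ω} {M : Type*} [TopologicalSpace M] [ChartedSpace H M]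
  [IsManifold I ∞ M]
  {E' : Type*} [NormedAddCommGroup E'] [NormedSpace ℝ E'] {H' : Type*} [TopologicalSpace H']
  {I' : ModelWithCorners ℝ E' H'} {N : Type*} [TopologicalSpace N] [ChartedSpace H' N]
  [IsManifold I' ∞ N]
  {g : LorentzianMetric I n M} {τ : TimeOrientation g}
  {gN : LorentzianMetric I' n N} {τN : TimeOrientation gN}

/-- **Pointwise timecone transport.** If `dφ_y` preserves scalar products
(`(φ^* g)_y = (g_N)_y`) and sends the orienting vector `T_N(y)` into the future cone of `M`, then
it sends every future-directed causal `v ∈ T_y N` to a future-directed causal vector (`dφ_y v` is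
causal, in the causal cone of the future timelike `dφ_y T_N(y)`; O'Neill 1983, Ch. 5, Lemma 5.29
and p. 145). The global form is `PreservesTimeOrientation.isFutureDirected_mfderiv`.
[cite: ONeillSemiRiemannian1983, Ch. 5, Lemma 5.29 and p. 145] -/
theorem TimeOrientation.isFutureDirected_mfderiv_at {φ : N → M} {y : N}
    (hτ : τ.IsFutureDirected (mfderiv I' I φ y (τN.vectorField y)))
    (hφ : pullbackBilin (I := I) (I' := I') φ g.val y = gN.val y)
    {v : TangentSpace I' y} (hv : τN.IsFutureDirected v) :
    τ.IsFutureDirected (mfderiv I' I φ y v) := by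
  have key : ∀ u w : TangentSpace I' y,
      g.val (φ y) (mfderiv I' I φ y u) (mfderiv I' I φ y w) = gN.val y u w := fun u w ↦ by
    have h := congrArg (fun b ↦ b u w) hφ
    simpa only [pullbackBilin_apply] using h
  have hT : g.IsTimelike (mfderiv I' I φ y (τN.vectorField y)) := by
    rw [LorentzianMetric.isTimelike_iff, key]; exact τN.isTimelike y
  have hvc : g.IsCausal (mfderiv I' I φ y v) := by
    refine ⟨by rw [key]; exact hv.1.1, fun h0 ↦ hv.1.2 ?_⟩
    apply gN.nondegenerate y v
    intro w
    rw [← key, h0, map_zero, _root_.zero_apply]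
  refine τ.isFutureDirected_of_val_lt_zero hτ hT hvc ?_
  rw [key]; exact hv.2

end Timecone

/-! ### The one-jet along the data hypersurface, pointwise hypotheses -/

section DataEmbedding

variable {n : ℕ} {X' : Type u} [TopologicalSpace X'] [ChartedSpace (EuclideanSpace ℝ (Fin n)) X']
  [IsManifold (𝓡 n) ∞ X'] [ConnectedSpace X'] {D : InitialDataSet (𝓡 n) X'}

namespace DataEmbedding

/-- Chain rule along the data hypersurface, pointwise: if `ψ (ι₁ x') = ι₂ x'` for all `x'` and
`ψ` is differentiable at `ι₁ x`, then `dψ (dι₁ v) = dι₂ v` at `x`. [cite: Sbierski2016AHP, §3.1, proof of the corollary to the first lemma] -/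
theorem mfderiv_comp_embed_apply_at (𝒮₁ 𝒮₂ : DataEmbedding D) {ψ : 𝒮₁.carrier → 𝒮₂.carrier}
    {x : X'} (hψ : MDifferentiableAt (𝓡 (n + 1)) (𝓡 (n + 1)) ψ (𝒮₁.embed x))
    (hψι : ψ ∘ 𝒮₁.embed = 𝒮₂.embed) (v : TangentSpace (𝓡 n) x) :
    mfderiv (𝓡 (n + 1)) (𝓡 (n + 1)) ψ (𝒮₁.embed x) (mfderiv (𝓡 n) (𝓡 (n + 1)) 𝒮₁.embed x v) =
      mfderiv (𝓡 n) (𝓡 (n + 1)) 𝒮₂.embed x v := by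
  have h := mfderiv_comp x hψ (𝒮₁.mdifferentiable_embed x)
  rw [hψι] at h
  exact (congrArg (fun L ↦ L v) h).symm

/-- **A map of data embeddings sends the future unit normal to the future unit normal — pointwise
hypotheses.** If `ψ : M₁ → M₂` is differentiable at `ι₁ x`, `dψ_{ι₁ x}` preserves scalar products
and sends `T₁(ι₁ x)` into the future cone, and `ψ ∘ ι₁ = ι₂`, then `dψ (ν₁ x) = ν₂ x`: the image is
a future unit normal to `dι₂(T_x X)` and the future unit normal is unique
(`TimeOrientation.eq_of_isFutureUnitNormal`). Sbierski 2016, §3.1 (proof of the corollary to the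
first lemma); the global form is `DataEmbedding.mfderiv_normal`. [cite: Sbierski2016AHP, §3.1, proof of the corollary to the first lemma] -/
theorem mfderiv_normal_at (𝒮₁ 𝒮₂ : DataEmbedding D) {ψ : 𝒮₁.carrier → 𝒮₂.carrier} {x : X'}
    (hψ : MDifferentiableAt (𝓡 (n + 1)) (𝓡 (n + 1)) ψ (𝒮₁.embed x))
    (hψi : pullbackBilin (I := 𝓡 (n + 1)) (I' := 𝓡 (n + 1)) ψ 𝒮₂.metric.val (𝒮₁.embed x) =
      𝒮₁.metric.val (𝒮₁.embed x))
    (hψτ : 𝒮₂.timeOrientation.IsFutureDirected (mfderiv (𝓡 (n + 1)) (𝓡 (n + 1)) ψ (𝒮₁.embed x)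
      (𝒮₁.timeOrientation.vectorField (𝒮₁.embed x))))
    (hψι : ψ ∘ 𝒮₁.embed = 𝒮₂.embed) :
    mfderiv (𝓡 (n + 1)) (𝓡 (n + 1)) ψ (𝒮₁.embed x) (𝒮₁.normal x) = 𝒮₂.normal x := by
  have hx : ψ (𝒮₁.embed x) = 𝒮₂.embed x := congrFun hψι x
  have key : ∀ u w : TangentSpace (𝓡 (n + 1)) (𝒮₁.embed x),
      𝒮₂.metric.val (ψ (𝒮₁.embed x)) (mfderiv (𝓡 (n + 1)) (𝓡 (n + 1)) ψ (𝒮₁.embed x) u)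
        (mfderiv (𝓡 (n + 1)) (𝓡 (n + 1)) ψ (𝒮₁.embed x) w) =
      𝒮₁.metric.val (𝒮₁.embed x) u w := fun u w ↦ by
    have h := congrArg (fun b ↦ b u w) hψi
    simpa only [pullbackBilin_apply] using h
  refine 𝒮₂.timeOrientation.eq_of_isFutureUnitNormal hx.symm (mfderiv (𝓡 n) (𝓡 (n + 1)) 𝒮₂.embed x)
    (fun v hv ↦ 𝒮₂.val_mfderiv_embed_pos x hv) (finrank_tangentSpace_add_one x)
    (𝒮₂.isFutureUnitNormal.1.1 x) (𝒮₂.isFutureUnitNormal.1.2 x) (𝒮₂.isFutureUnitNormal.2 x)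
    (fun v ↦ ?_) ?_ ?_
  · rw [← mfderiv_comp_embed_apply_at 𝒮₁ 𝒮₂ hψ hψι v, key]
    exact 𝒮₁.isFutureUnitNormal.1.1 x v
  · rw [key]
    exact 𝒮₁.isFutureUnitNormal.1.2 x
  · exact TimeOrientation.isFutureDirected_mfderiv_at hψτ hψi (𝒮₁.isFutureUnitNormal.2 x)

/-- **The differential along the data hypersurface is determined by the data — pointwise
hypotheses.** Two maps `ψ, ψ' : M₁ → M₂`, each differentiable at `ι₁ x` with scalar-product
preserving differential there sending `T₁(ι₁ x)` into the future cone, and with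
`ψ ∘ ι₁ = ι₂ = ψ' ∘ ι₁`, have the same differential at `ι₁ x`: both send `dι₁ v ↦ dι₂ v` and
`ν₁ ↦ ν₂`, and `T_{ι₁ x} M₁ = dι₁(T_x X) ⊕ ℝ ν₁`. Sbierski 2016, §3.1 ("Thus, the differentials of
`ψ₁` and `ψ₂` agree on `Σ`") and §3.2, proof of Thm. 12 ("`(dψ)|_S = (dφ)|_S`").
[cite: Sbierski2016AHP, §3.2, proof of Thm. 12] -/
theorem mfderiv_eq_mfderiv_of_comp_embed_eq_at (𝒮₁ 𝒮₂ : DataEmbedding D)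
    {ψ ψ' : 𝒮₁.carrier → 𝒮₂.carrier} {x : X'}
    (hψ : MDifferentiableAt (𝓡 (n + 1)) (𝓡 (n + 1)) ψ (𝒮₁.embed x))
    (hψi : pullbackBilin (I := 𝓡 (n + 1)) (I' := 𝓡 (n + 1)) ψ 𝒮₂.metric.val (𝒮₁.embed x) =
      𝒮₁.metric.val (𝒮₁.embed x))
    (hψτ : 𝒮₂.timeOrientation.IsFutureDirected (mfderiv (𝓡 (n + 1)) (𝓡 (n + 1)) ψ (𝒮₁.embed x)
      (𝒮₁.timeOrientation.vectorField (𝒮₁.embed x))))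
    (hψι : ψ ∘ 𝒮₁.embed = 𝒮₂.embed)
    (hψ' : MDifferentiableAt (𝓡 (n + 1)) (𝓡 (n + 1)) ψ' (𝒮₁.embed x))
    (hψ'i : pullbackBilin (I := 𝓡 (n + 1)) (I' := 𝓡 (n + 1)) ψ' 𝒮₂.metric.val (𝒮₁.embed x) =
      𝒮₁.metric.val (𝒮₁.embed x))
    (hψ'τ : 𝒮₂.timeOrientation.IsFutureDirected (mfderiv (𝓡 (n + 1)) (𝓡 (n + 1)) ψ' (𝒮₁.embed x)
      (𝒮₁.timeOrientation.vectorField (𝒮₁.embed x))))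
    (hψ'ι : ψ' ∘ 𝒮₁.embed = 𝒮₂.embed) (w : TangentSpace (𝓡 (n + 1)) (𝒮₁.embed x)) :
    mfderiv (𝓡 (n + 1)) (𝓡 (n + 1)) ψ (𝒮₁.embed x) w =
      mfderiv (𝓡 (n + 1)) (𝓡 (n + 1)) ψ' (𝒮₁.embed x) w := by
  obtain ⟨v, hw⟩ := 𝒮₁.exists_eq_mfderiv_embed_add_smul_normal x w
  rw [hw, map_add, map_smul, map_add, map_smul, mfderiv_comp_embed_apply_at 𝒮₁ 𝒮₂ hψ hψι,
    mfderiv_comp_embed_apply_at 𝒮₁ 𝒮₂ hψ' hψ'ι, mfderiv_normal_at 𝒮₁ 𝒮₂ hψ hψi hψτ hψι,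
    mfderiv_normal_at 𝒮₁ 𝒮₂ hψ' hψ'i hψ'τ hψ'ι]
  rfl

/-- **Variant with a prescribed normal image.** If `ψ` is differentiable at `ι₁ x`, carries `ι₁` to
`ι₂`, and is KNOWN to send `ν₁ x` to `ν₂ x`, while `ψ'` satisfies the pointwise isometry /
orientation hypotheses of `mfderiv_normal_at` and carries `ι₁` to `ι₂`, then `dψ = dψ'` at `ι₁ x`.
(Used when `ψ` sends `ν₁` to `ν₂` by construction of `ν₂`.) [cite: Sbierski2016AHP, §3.2, proof of Thm. 12] -/
theorem mfderiv_eq_mfderiv_of_mfderiv_normal_eq_at (𝒮₁ 𝒮₂ : DataEmbedding D)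
    {ψ ψ' : 𝒮₁.carrier → 𝒮₂.carrier} {x : X'}
    (hψ : MDifferentiableAt (𝓡 (n + 1)) (𝓡 (n + 1)) ψ (𝒮₁.embed x))
    (hψι : ψ ∘ 𝒮₁.embed = 𝒮₂.embed)
    (hψν : mfderiv (𝓡 (n + 1)) (𝓡 (n + 1)) ψ (𝒮₁.embed x) (𝒮₁.normal x) = 𝒮₂.normal x)
    (hψ' : MDifferentiableAt (𝓡 (n + 1)) (𝓡 (n + 1)) ψ' (𝒮₁.embed x))
    (hψ'i : pullbackBilin (I := 𝓡 (n + 1)) (I' := 𝓡 (n + 1)) ψ' 𝒮₂.metric.val (𝒮₁.embed x) =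
      𝒮₁.metric.val (𝒮₁.embed x))
    (hψ'τ : 𝒮₂.timeOrientation.IsFutureDirected (mfderiv (𝓡 (n + 1)) (𝓡 (n + 1)) ψ' (𝒮₁.embed x)
      (𝒮₁.timeOrientation.vectorField (𝒮₁.embed x))))
    (hψ'ι : ψ' ∘ 𝒮₁.embed = 𝒮₂.embed) (w : TangentSpace (𝓡 (n + 1)) (𝒮₁.embed x)) :
    mfderiv (𝓡 (n + 1)) (𝓡 (n + 1)) ψ (𝒮₁.embed x) w =
      mfderiv (𝓡 (n + 1)) (𝓡 (n + 1)) ψ' (𝒮₁.embed x) w := by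
  obtain ⟨v, hw⟩ := 𝒮₁.exists_eq_mfderiv_embed_add_smul_normal x w
  rw [hw, map_add, map_smul, map_add, map_smul, mfderiv_comp_embed_apply_at 𝒮₁ 𝒮₂ hψ hψι,
    mfderiv_comp_embed_apply_at 𝒮₁ 𝒮₂ hψ' hψ'ι, hψν, mfderiv_normal_at 𝒮₁ 𝒮₂ hψ' hψ'i hψ'τ hψ'ι]
  rfl

end DataEmbedding

end DataEmbedding

end Literature.Geometry.Lorentzian

end
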